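import Literature.Analysis.Complex.PickFunctionsProofsDisc
import Literature.Analysis.Fourier.HilbertTransformCircleMoebius
import HarnessLib

/-!
# The constant in the conformal covariance of the conjugate function as a conjugate-Poisson integral

Topic `Literature/Analysis/Fourier`. In `HilbertTransformCircleMoebius.lean` the periodic Hilbert transform `H = hilbertTransformCircle`
(`H cos = sin`) was shown to be covariant under the boundary map `φ` of the disc automorphism `Φ_ρ(w) = (w − ρ)/(1 − ρw)` up to the
constant `Im g(0) − Im g(−ρ)` (`g` the holomorphic function with `f = Re g` on the circle). Here that constant is written as the
engine-side integral: by Schwarz's formula (`Literature.Analysis.Complex.circleAverage_herglotz_kernel_mul_re`, imaginary part)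

  `Im g(w) − Im g(0) = (2π)⁻¹ ∫₀^{2π} Im((e^{iθ} + w)/(e^{iθ} − w)) · Re g(e^{iθ}) dθ`   (`|w| < 1`),

and at the real point `w = −ρ` the kernel is the conjugate Poisson kernel `2ρ sin θ/(1 + 2ρ cos θ + ρ²)`, so that

  `H[f ∘ φ](x) = (Hf)(φ(x)) − (2π)⁻¹ ∫₀^{2π} f(θ) · 2ρ sin θ/(1 + 2ρ cos θ + ρ²) dθ`

(`hilbertTransformCircle_re_moebius_integral`, and in trigonometric-polynomial letters `hilbertTransformCircle_trigPoly_moebius_integral`).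
With `ρ = (s − 1)/(s + 1)` the kernel reads `(s² − 1) sin θ/((s² + 1) + (s² − 1) cos θ)` — the form in which a conformally adapted
(`θ = 2 arctan(s tan(x/2))`) Fourier collocation scheme for a 1-D non-local model evaluates the Hilbert transform of band-limited
data in the mapped variable. Classical statements [cite: Katznelson2004, Ch. III §1 (conjugate function, conjugate Poisson kernel)];
no definitions, no named facts.
-/

noncomputable section

namespace Literature.Analysis.Fourier

open _root_.Complex Set Metric _root_.MeasureTheory
open scoped Real

/-! ### Schwarz's formula, imaginary part -/

/-- **Conjugate-Poisson representation of the harmonic conjugate.** For `g` holomorphic on the unit disc and continuous up to the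
boundary and `|w| < 1`: the circle average of `Im((ζ + w)/(ζ − w)) · Re g(ζ)` is `Im g(w) − Im g(0)` (imaginary part of Schwarz's
integral formula). [cite: Katznelson2004, Ch. III §1 (conjugate Poisson kernel; harmonic conjugate of the Poisson integral)] -/
theorem circleAverage_herglotz_im_mul_re {g : ℂ → ℂ} (hg : DiffContOnCl ℂ g (ball 0 1)) {w : ℂ}
    (hw : w ∈ ball (0 : ℂ) 1) :
    Real.circleAverage (fun ζ => ((ζ + w) / (ζ - w)).im * (g ζ).re) 0 1 = (g w).im - (g 0).im := by
  have h := Literature.Analysis.Complex.circleAverage_herglotz_kernel_mul_re hg hw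
  have hgc : ContinuousOn g (sphere (0 : ℂ) 1) := by
    have := hg.continuousOn
    rw [closure_ball (0 : ℂ) one_ne_zero] at this
    exact this.mono sphere_subset_closedBall
  have hi : CircleIntegrable (fun ζ => (ζ + w) / (ζ - w) * ((g ζ).re : ℂ)) 0 1 :=
    ((Literature.Analysis.Complex.continuousOn_herglotz_kernel hw).mul
      (continuous_ofReal.comp_continuousOn (continuous_re.comp_continuousOn hgc))).circleIntegrable zero_le_one
  have h2 := ContinuousLinearMap.circleAverage_comp_comm imCLM hi
  rw [h] at h2
  simp only [imCLM_apply, sub_im, mul_im, I_re, ofReal_im, mul_zero, I_im, ofReal_re, one_mul,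
    zero_add] at h2
  rw [← h2]
  congr 1
  funext ζ
  simp [Complex.mul_im]

/-- On the unit circle the imaginary part of the Herglotz kernel at a real point `w = −ρ` is the conjugate Poisson kernel:
`Im((e^{iθ} − ρ)/(e^{iθ} + ρ)) = 2ρ sin θ/(1 + 2ρ cos θ + ρ²)` (helper). [folklore] -/
private theorem herglotz_im_real_point {ρ : ℝ} (hρ : |ρ| < 1) (θ : ℝ) :
    ((Complex.exp (θ * I) + (-(ρ : ℂ))) / (Complex.exp (θ * I) - (-(ρ : ℂ)))).im
      = 2 * ρ * Real.sin θ / (1 + 2 * ρ * Real.cos θ + ρ ^ 2) := by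
  have hcs : Real.cos θ ^ 2 + Real.sin θ ^ 2 = 1 := Real.cos_sq_add_sin_sq θ
  have hD : 0 < 1 + 2 * ρ * Real.cos θ + ρ ^ 2 := by
    have h1 := abs_lt.mp hρ
    have hc1 := Real.cos_le_one θ
    have hc2 := Real.neg_one_le_cos θ
    rcases le_or_gt 0 ρ with h | h
    · have h2 : -ρ ≤ ρ * Real.cos θ := by nlinarith
      nlinarith [mul_pos (sub_pos.2 h1.2) (sub_pos.2 h1.2)]
    · have h2 : ρ ≤ ρ * Real.cos θ := by nlinarith
      nlinarith [mul_pos (neg_pos.2 h) (neg_pos.2 h), h1.1]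
  have hns : Complex.normSq (Complex.exp (θ * I) - (-(ρ : ℂ))) = 1 + 2 * ρ * Real.cos θ + ρ ^ 2 := by
    rw [Complex.exp_mul_I, ← Complex.ofReal_cos, ← Complex.ofReal_sin, Complex.normSq_apply]
    simp only [Complex.sub_re, Complex.add_re, Complex.ofReal_re, Complex.mul_re, Complex.I_re, Complex.ofReal_im,
      Complex.I_im, Complex.neg_re, Complex.sub_im, Complex.add_im, Complex.mul_im, Complex.neg_im]
    nlinarith [hcs]
  rw [Complex.div_im, hns]
  rw [Complex.exp_mul_I, ← Complex.ofReal_cos, ← Complex.ofReal_sin]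
  simp only [Complex.sub_re, Complex.add_re, Complex.ofReal_re, Complex.mul_re, Complex.I_re, Complex.ofReal_im,
    Complex.I_im, Complex.neg_re, Complex.sub_im, Complex.add_im, Complex.mul_im, Complex.neg_im]
  field_simp
  ring

/-- **The harmonic conjugate at a real interior point as a conjugate-Poisson integral.** For `g` holomorphic on the unit disc and
continuous up to the boundary and `|ρ| < 1`:
`Im g(−ρ) − Im g(0) = (2π)⁻¹ ∫₀^{2π} (2ρ sin θ/(1 + 2ρ cos θ + ρ²)) · Re g(e^{iθ}) dθ`.
[cite: Katznelson2004, Ch. III §1 (conjugate Poisson kernel)] -/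
theorem im_sub_im_eq_integral_conjPoisson {g : ℂ → ℂ} (hg : DiffContOnCl ℂ g (ball 0 1)) {ρ : ℝ} (hρ : |ρ| < 1) :
    (g (-ρ)).im - (g 0).im = (2 * π)⁻¹ * ∫ θ in (0 : ℝ)..2 * π,
      2 * ρ * Real.sin θ / (1 + 2 * ρ * Real.cos θ + ρ ^ 2) * (g (Complex.exp (θ * I))).re := by
  have hw : (-(ρ : ℂ)) ∈ ball (0 : ℂ) 1 := by
    rw [mem_ball_zero_iff, norm_neg, Complex.norm_real, Real.norm_eq_abs]
    exact hρ
  have h := circleAverage_herglotz_im_mul_re hg hw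
  rw [Real.circleAverage_def, smul_eq_mul] at h
  rw [← h]
  congr 1
  refine intervalIntegral.integral_congr fun θ _ => ?_
  simp only [circleMap_zero, Complex.ofReal_one, one_mul]
  rw [herglotz_im_real_point hρ θ]

/-! ### The covariance constant as an integral -/

/-- **Conformal covariance with the constant as a conjugate-Poisson integral.** For `g` holomorphic on an open neighbourhood of the
closed unit disc, `|ρ| < 1` and any lift `φ` of the boundary map of `Φ_ρ(w) = (w − ρ)/(1 − ρw)`:
`H[y ↦ Re g(e^{iφ(y)})](x) = H[θ ↦ Re g(e^{iθ})](φ x) − (2π)⁻¹ ∫₀^{2π} (2ρ sin θ/(1 + 2ρ cos θ + ρ²)) Re g(e^{iθ}) dθ`.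
[cite: Katznelson2004, Ch. III §1 (conjugate function; conjugate Poisson kernel)] -/
theorem hilbertTransformCircle_re_moebius_integral {g : ℂ → ℂ} {U : Set ℂ} (hU : IsOpen U)
    (hsub : closedBall (0 : ℂ) 1 ⊆ U) (hg : DifferentiableOn ℂ g U) {ρ : ℝ} (hρ : |ρ| < 1) {φ : ℝ → ℝ}
    (hφ : ∀ y : ℝ, Complex.exp (φ y * I) = (Complex.exp (y * I) - ρ) / (1 - ρ * Complex.exp (y * I))) (x : ℝ) :
    hilbertTransformCircle (fun y : ℝ => (g (Complex.exp (φ y * I))).re) x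
      = hilbertTransformCircle (fun θ : ℝ => (g (Complex.exp (θ * I))).re) (φ x)
        - (2 * π)⁻¹ * ∫ θ in (0 : ℝ)..2 * π,
            2 * ρ * Real.sin θ / (1 + 2 * ρ * Real.cos θ + ρ ^ 2) * (g (Complex.exp (θ * I))).re := by
  rw [hilbertTransformCircle_re_moebius hU hsub hg hρ hφ x,
    ← im_sub_im_eq_integral_conjPoisson (hg.diffContOnCl_ball hsub) hρ]
  ring

/-- The same with an almost-everywhere lift (and the lift condition at the point `x`).
[cite: Katznelson2004, Ch. III §1 (conjugate function; conjugate Poisson kernel)] -/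
theorem hilbertTransformCircle_re_moebius_integral_ae {g : ℂ → ℂ} {U : Set ℂ} (hU : IsOpen U)
    (hsub : closedBall (0 : ℂ) 1 ⊆ U) (hg : DifferentiableOn ℂ g U) {ρ : ℝ} (hρ : |ρ| < 1) {φ : ℝ → ℝ}
    (hφ : ∀ᵐ y : ℝ, Complex.exp (φ y * I) = (Complex.exp (y * I) - ρ) / (1 - ρ * Complex.exp (y * I))) {x : ℝ}
    (hx : Complex.exp (φ x * I) = (Complex.exp (x * I) - ρ) / (1 - ρ * Complex.exp (x * I))) :
    hilbertTransformCircle (fun y : ℝ => (g (Complex.exp (φ y * I))).re) x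
      = hilbertTransformCircle (fun θ : ℝ => (g (Complex.exp (θ * I))).re) (φ x)
        - (2 * π)⁻¹ * ∫ θ in (0 : ℝ)..2 * π,
            2 * ρ * Real.sin θ / (1 + 2 * ρ * Real.cos θ + ρ ^ 2) * (g (Complex.exp (θ * I))).re := by
  rw [hilbertTransformCircle_re_moebius_ae hU hsub hg hρ hφ hx,
    ← im_sub_im_eq_integral_conjPoisson (hg.diffContOnCl_ball hsub) hρ]
  ring

/-- **Trigonometric polynomials, constant as an integral.** For `|ρ| < 1`, an a.e. lift `φ` of the boundary map of `Φ_ρ` that is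
also a lift at `x`, and the trigonometric polynomial `T(θ) = c + Σ_{k<n} (α_k sin((k+1)θ) + β_k cos((k+1)θ))`:
`H[T ∘ φ](x) = (HT)(φ x) − (2π)⁻¹ ∫₀^{2π} (2ρ sin θ/(1 + 2ρ cos θ + ρ²)) T(θ) dθ`, with `(HT)` the termwise multiplier
(`hilbertTransformCircle_trigPoly_eq`). [cite: Katznelson2004, Ch. III §1 (conjugate function; conjugate Poisson kernel)] -/
theorem hilbertTransformCircle_trigPoly_moebius_integral {ρ : ℝ} (hρ : |ρ| < 1) {φ : ℝ → ℝ}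
    (hφ : ∀ᵐ y : ℝ, Complex.exp (φ y * I) = (Complex.exp (y * I) - ρ) / (1 - ρ * Complex.exp (y * I))) {x : ℝ}
    (hx : Complex.exp (φ x * I) = (Complex.exp (x * I) - ρ) / (1 - ρ * Complex.exp (x * I)))
    (n : ℕ) (c : ℝ) (α β : ℕ → ℝ) :
    hilbertTransformCircle (fun y => c + ∑ k ∈ Finset.range n,
        (α k * Real.sin (((k + 1 : ℕ) : ℝ) * φ y) + β k * Real.cos (((k + 1 : ℕ) : ℝ) * φ y))) x =
      hilbertTransformCircle (fun θ => c + ∑ k ∈ Finset.range n,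
          (α k * Real.sin (((k + 1 : ℕ) : ℝ) * θ) + β k * Real.cos (((k + 1 : ℕ) : ℝ) * θ))) (φ x)
        - (2 * π)⁻¹ * ∫ θ in (0 : ℝ)..2 * π,
            2 * ρ * Real.sin θ / (1 + 2 * ρ * Real.cos θ + ρ ^ 2)
              * (c + ∑ k ∈ Finset.range n,
                  (α k * Real.sin (((k + 1 : ℕ) : ℝ) * θ) + β k * Real.cos (((k + 1 : ℕ) : ℝ) * θ))) := by
  set G : ℂ → ℂ := fun w => (c : ℂ) + ∑ k ∈ Finset.range n, (((β k : ℝ) : ℂ) - ((α k : ℝ) : ℂ) * I) * w ^ (k + 1)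
    with hG
  have hGd : Differentiable ℂ G := by
    rw [hG]
    fun_prop
  have hre : ∀ θ : ℝ, (G (Complex.exp (θ * I))).re = c + ∑ k ∈ Finset.range n,
      (α k * Real.sin (((k + 1 : ℕ) : ℝ) * θ) + β k * Real.cos (((k + 1 : ℕ) : ℝ) * θ)) :=
    fun θ => (trigPoly_eq_re_analyticPoly n c α β θ).symm
  have key := hilbertTransformCircle_re_moebius_integral_ae isOpen_univ (subset_univ _) hGd.differentiableOn hρ hφ hx
  simp only [hre] at key
  exact key

end Literature.Analysis.Fourier
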